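import Mathlib
import HarnessLib
import HarnessLib.Audit
import Summits.NavierStokesRegularity.Statement
import Literature.Analysis.FluidPDE.ClassicalSolution
import Literature.Analysis.FluidPDE.LerayHopf
import Literature.Analysis.FluidPDE.SuitableWeak
import Literature.Analysis.FluidPDE.HelicalSectorSeminorm
import Literature.Analysis.FunctionSpaces.FourierSobolevNorm
import Literature.Analysis.FunctionSpaces.Complexify
import Summits.NavierStokesRegularity.NavierStokesRegularity.Theorems.NoBlowupToClay
import HarnessLib.Audit.Status.Attr

/-!
Route: RootDecompChiralityLadder

# Route RootDecompChiralityLadder — Chirality ladder — grade a blow-up by the size of one helical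
sector; one-sector criteria below the ambichiral residual

WRITER BOOKING (decomp-ns-writer-1 g3, TREE node N12, top-level node refining the B1 blocker
TypeILiouville.TypeIliouvilleNoTypeII stmt-NavierStokesRegularity-0056; `--refines
route-NavierStokesRegularity-TypeILiouville:stmt-NavierStokesRegularity-0056` is the honest parent
pointer once that gate flag exists): lens file HOME/decomp-ns-lens-1/ChiralityLadder.lean sha256
64a8c04c88210ef52461cb9983850e0b2a2f85ddccc4fbd7cc8d92da8c464ef9 (rc 0 / 0 sorry; BC7 4/4 CLEAN),
NODE-g5.md sha256 0749394165234ebed50d92153b416922c485fe94517c6e977df64b54c7a042d5, booking kit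
HOME/decomp-ns-lens-1/kit-ChiralityLadder/ (route.asides.json sha256 d4789b18…, glue.lean
7c69ddac…); critic CRITIC-LEDGER row 55 CLEARED + REV1 row 57; census COSTUME-CENSUS-v4.json sha256
223d76035ae72257226c6fcc2ce2d98c802bf8bb311215bb5ebd762a439af952 row C39/H43 (chirality ladder).
Piece tags: X₁ WEAKER · NOT IN PRINT · ATTACKABLE NOW (BC3 skeleton, first prover target); X₂ WEAKER
· IDEA-NEEDED (one-sector ESS endpoint); X₃′ UNDECIDED-consistent · DECLARED RESIDUAL · LOADED
(ambichiral Type-II scenarios: Hou 2022, Tao cascade); P1 = 1217 verbatim; supports R₀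
OneSectorCriticalEnergyExtends COSTUME(cite LV22 Thm 9), R_ε SmallSectorExtends, ChiralGronwallBound
= asides (skeleton stubs). Why this is novel: no born node N1–N11 and no census route grades a
blow-up by CHIRALITY — the one-sector (spin-definite Fourier sector) refinements X₁/X₂ of
Lerner–Vigneron's simultaneity theorem are stated nowhere in print and use the exact shared transfer
term τ of NS (HOME = run/shared/lean/pub/decomp-ns).
Root decomposition node (decomp-ns lens-1 «grading / quantitative ladder», gen 5, RESIDUAL MODE;
CLEARED by decomp-ns-crit-1-g2,
CRITIC-LEDGER row 55; refines the B1 blocker TypeILiouville.TypeIliouvilleNoTypeII =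
stmt-NavierStokesRegularity-0056). It suffices to show
X = X₁ ∧ X₂ ∧ X₃′ ∧ P1: X₁ = OneSectorDissipationExtends (a classical Leray–Hopf solution ONE of
whose helical sectors u^σ = Q_σ u has
finite Ḣ^{3/2}-dissipation on (0,T) extends past T), X₂ = OneSectorCriticalExtends (one helical
sector bounded in Ḣ^{1/2} on [0,T) ⟹ extends),
X₃′ = NoAmbichiralTypeIIBlowup (declared residual: no Type-II blow-up with both sectors wild), P1 =
NoTypeIBlowup (stmt-1217 verbatim).
X ⟺ S exactly (excluded middle on Type I / polarised dissipation / polarised critical size inside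
the landed frame S ⟺ NoBlowup;
kernel root_iff_pieces in the seat file HOME/decomp-ns-lens-1/ChiralityLadder.lean).
Lean: `OneSectorDissipationExtends ∧ OneSectorCriticalExtends ∧ NoAmbichiralTypeIIBlowup ∧
NoTypeIBlowup`

## Assembly
Pure logic inside the landed frame: Theorems.navierStokesRegularity_of_noBlowup reduces Clay (A) to
«every classical Leray–Hopf solution from a
rapidly decaying datum extends past T»; given such a solution, excluded middle on IsTypeIBlowup (→
P1), then on «some sector has finite
dissipation» (→ X₁), then on «some sector is critically bounded» (→ X₂), else X₃′. The deciding
theorem closes in glue.lean consumes all four.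

Rationale: WHY THIS LINE. Every divergence-free L² field splits Ḣ^s-orthogonally into spin-definite helical
sectors u = u⁺ + u⁻ (curl u^± = ±Λu^±; Waleffe1992,
LernerVigneron2022 §2) and Navier–Stokes couples them through ONE trilinear transfer term: ½h_σ' +
νd_σ = −τ for both σ with
τ = ∫det(ω⁻,u,ω⁺) (LernerVigneron2022 Prop. 14, LeiLinZhou2015 Thm 1.1), so the critical energies
N_σ = h_σ + 2ν∫d_σ differ by a constant and
diverge TOGETHER at a first singular time (LernerVigneron2022 Thm 9). The line grades the minor
sector in the scale-invariant one-sector classes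
L^r_t Ḣ^{1/2+2/r} and asks which PART of N_σ must diverge: the rung «both parts finite ⟹ regular» is
print (R₀, COSTUME(cite)); «dissipation
part finite ⟹ regular» (X₁, r = 2) is not in print and is attackable by a Grönwall argument on the
sector balance law whose every exponent has
been checked (seat file, module docstring; critic row 55 re-derived it); «sup part finite ⟹ regular»
(X₂, r = ∞) is the open one-sector
Escauriaza–Seregin–Šverák endpoint; the residual X₃′ keeps the ambichiral Type-II scenarios.
Imported area: helical-mode (Beltrami spectrum)
analysis of turbulence (Waleffe1992, BiferaleTiti2013) pointed at blow-up classification; no prior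
route or negatives entry grades a blow-up
by chirality (tree helical content: Theses/QuantisedSymmetry bookkeeping, Literature
HelicalTriadInstability, NearBeltramiEnstrophyCriterion —
x-space pointwise alignment, not Fourier sectors).

RANKED CRUXES. #2 OneSectorDissipationExtends (crux) — ONE-SECTOR DISSIPATION CRITERION (X₁, r = 2
rung; WEAKER · ATTACKABLE NOW) — for ν>0, T>0 and (u,p) classical NS on ℝ³×[0,T), Leray–Hopf from
the rapidly decaying slice u(0): if for some σ ∈ {1,−1} the spin-σ sector has finite
Ḣ^{3/2}-dissipation on (0,T) (certified by a measurable integrable majorant), then u extends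
smoothly past T. [difficulty: L] (why it might fail: only through the regularity bookkeeping of the
sector balance law along tree classical solutions (time-differentiability of h_σ, finiteness of d_σ
before T); the Gronwall chain itself is checked exponent by exponent.) [arXiv:2203.07950,
arXiv:1505.00142, arXiv:1303.1215, EscauriazaSereginSverak2003]
#3 OneSectorCriticalExtends (crux) — ONE-SECTOR ESS (X₂, r = ∞ rung; WEAKER · IDEA-NEEDED) — same
frame: if for some σ ∈ {1,−1} the spin-σ sector is bounded in Ḣ^{1/2} on [0,T) by a finite M, then u
extends smoothly past T. [difficulty: open-problem] (why it might fail: a Type-II blow-up whose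
minor sector stays Ḣ^{1/2}-bounded while out-dissipating the major one at ever higher frequencies is
excluded by nothing known; the transfer bound needs the supercritical ‖u⁺‖_{Ḣ²}.) [arXiv:2203.07950,
arXiv:1505.00142, CheminZhangZhang2017, EscauriazaSereginSverak2003]
#4 NoAmbichiralTypeIIBlowup (crux) — NO AMBICHIRAL TYPE-II BLOW-UP (X₃′, DECLARED RESIDUAL; weaker
than 0056 by kernel) — same frame: if u is NOT Type I at T and for every σ ∈ {1,−1} the spin-σ
sector has infinite Ḣ^{3/2}-dissipation on (0,T) and is unbounded in Ḣ^{1/2} on [0,T), then u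
extends smoothly past T. [difficulty: open-problem] (why it might fail: it is NoTypeII (0056) off
the two chirally polarised cells: every mirror-symmetric blow-up candidate (e.g. Luo–Hou 2014) and
morally Tao's averaged cascade live here; no attack is proposed.) [arXiv:1402.0290,
arXiv:2107.06509, arXiv:2203.07950, Fefferman2000]
#5 NoTypeIBlowup (crux) — NO TYPE-I BLOW-UP FOR CLAY DATA (P1 = stmt-NavierStokesRegularity-1217
verbatim, residual of record shared with N1/N5/N6/N8) — same frame: if u is Type I at T then u
extends smoothly past T. [difficulty: open-problem] (why it might fail: a backward self-similar /
DSS Type-I profile realised from a Schwartz datum refutes it; the Liouville conjecture for bounded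
ancient mild solutions (KNSS) is open.) [arXiv:0709.3599, KochNadirashviliSereginSverak2009,
arXiv:1811.00502]
#9 OneSectorCriticalEnergyExtends (support) — RUNG OF RECORD R₀ (COSTUME(cite): Lerner–Vigneron Thm
9 / Lei–Lin–Zhou with GKP16 = tree fact hasSmoothExtensionPast_of_eLpNorm_three_bounded_holds) —
same frame: if one sector is bounded in Ḣ^{1/2} AND has finite Ḣ^{3/2}-dissipation, u extends; below
X₁ and X₂. [difficulty: M] [arXiv:2203.07950, arXiv:1505.00142]
#9 SmallSectorExtends (support) — RUNG R_ε below X₂ (BC5 witness, plan-only, EXPECTED THEOREM by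
bootstrap) — for every ν>0 and every bound K on the initial major sector there is ε>0 such that, in
the same frame, if for some σ ∈ {1,−1} the spin-(−σ) sector of u(0) has squared Ḣ^{1/2}-seminorm ≤ K
and the spin-σ sector stays ≤ ε in squared Ḣ^{1/2}-seminorm on [0,T), then u extends smoothly past T
(large data allowed). [difficulty: M] [arXiv:2203.07950, arXiv:1505.00142]
#9 ChiralGronwallBound (support) — BC3 STUB of X₁ (the PDE content) — same frame: finite
Ḣ^{3/2}-dissipation of one helical sector bounds the FULL solution in Ḣ^{1/2} on [0,T) (sector
balance law + transfer bound + helicity identity + Gronwall); with the Ḣ^{1/2}-ESS endpoint (proved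
in the seat file from FluidComputer.CriticalDivergence) it gives X₁. [difficulty: L]
[arXiv:2203.07950, arXiv:1505.00142, EscauriazaSereginSverak2003]

TWO-LAYER PLAN. X₁ ⇐ ChiralGronwallBound → (Ḣ^{1/2}-bounded ⟹ extends, proved in the seat file as
extends_of_homSobolevHalf_bounded) → X₁; X₂ ⇐ SmallSectorExtends
as first rung, then a frequency-localised version (the minor sector must out-dissipate the major one
at frequencies Λ₋ ≫ Λ₊; critic row 55).

KILL CRITERIA. A refutation of X₁ (a classical solution with one finite-dissipation sector that
blows up) closes the route outright (the ladder's first new rung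
would be false); a refutation of X₂ by an explicit polarised Type-II blow-up moves X₂'s cell into
the residual (pivot: X₃′ replaced by
NoAmbichiralBlowup ∧ ¬polarised, route survives on X₁); a proof of 0056 elsewhere moots X₁–X₃′ (then
S ⟺ P1).

NOT DECOMPOSED YET. The intermediate rungs 2 < r < ∞ (expected to fall to the X₁ template); the
frequency-localised form of X₂; the typed sector balance law
(a support lemma the X₁ prover will file with --supports).

CHEAPEST FALSIFIER. Re-derive the X₁ exponent chain (done twice: seat + critic row 55); then the
in-Lean check that DissipationFiniteOn/CriticallyBoundedOn are
junk-free on Leray–Hopf slices (eSeminormSq is a genuine lintegral on L², ⊤ off L²; M : ℝ≥0;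
measurable majorant) — BC7 probes 4/4 CLEAN.

DEFINITION REQUESTS. Literature/Analysis/FluidPDE/HelicalSectorSeminorm.lean (HelicalSector.icross /
spinSymbol / fourierL2 / eSeminormSq / DissipationFiniteOn /
CriticallyBoundedOn + spinSymbol_add) PROPOSED as p762480 (definition, reviewed); the items above
elaborate once it lands.

Novelty: Searches (2026-08-30): lit search --hybrid «helical decomposition one component regularity criterion
Navier-Stokes» (8 docs, textbooks only); lit vsearch «regularity criterion … only the positive
helical (spin-definite) component» (8 docs, none); lit galaxy search «helical
decomposition|spin-definite|helical modes» --star pdf (8 hits, none NS-regularity); galaxy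
«homochiral|helical wave decomposition|helical-decimated» (0 relevant); zbMATH «helical
decomposition Navier–Stokes» (14) and «helicity regularity Navier–Stokes» ≥2010 (17): LLZ15, BT13,
LV22, Ri 2021 — none one-sector; rg over Theses/Theorems for helical|spin-definite|Beltrami.
Nearest prior art found: arXiv:2203.07950 Thm 9 (one sector of finite critical energy N_σ ⟹
regular), Thm 11, Thm 13, Prop. 14; arXiv:1505.00142 Thm 1.1/1.2; arXiv:1303.1215 (homochiral NS
regular).
Delta: X₁ and X₂ are the two one-class refinements (dissipation part alone / sup part alone) of
Lerner–Vigneron's simultaneity theorem, neither stated in print, assembled with the Type-I/Type-II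
frame into an exact root decomposition.
Claimed grade: new-combination  [refs: 2203.07950, 1505.00142, 1303.1215]

Barriers (technique_class: helical-decomposition, critical-norm criterion, Gronwall): - technique_class: helical-decomposition, critical-norm criterion, Gronwall
- Literature.Barriers.NavierStokesRegularity.AveragedTypeIBlowup: X₁'s lever is the exact trilinear
transfer identity of NS (one τ shared by both sector balances), which an averaged bilinear operator
need not keep even when it keeps energy and helicity (Tao Rem. 4.3 keeps the helicity INTEGRAL only)
— outside for X₁; X₃′ does not evade it (declared residual); X₂: the bet is an NS-specific
one-sector ESS.
- Literature.Barriers.NavierStokesRegularity.NavierStokesInequalitySingularSolutionNarrow (file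
NavierStokesInequalitySingularSolutionsNarrow.lean) and
Literature.Barriers.NavierStokesRegularity.NSITypeIIBlowup: outside — X₁ and X₂ use the EQUATION
(the exact sector balance law with one shared transfer term τ, and backward-uniqueness/ESS), not
only the energy class + local energy inequality of an NSI weak solution; Scheffer/Ożański switched
fields are not Leray–Hopf solutions of NS (energy jumps), so they do not instantiate the frame.
- Averaged-equation step test
(Literature/Barriers/NavierStokesRegularity/AveragedEquationStepTest.lean, `StepTest` vocabulary;
not a catalogued fact): X₁/X₂ are CONTINUATION CRITERIA (the (C)-half, where genuine theorems live:
ESS, GKP16, Kenig–Koch); the route never asserts the (A)-half «one sector stays small a priori» —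
its failure is exactly the declared residual X₃′ — so the step test is honoured, not beaten.
- Literature.Barriers.NavierStokesRegularity.BeltramiNon

sub-problem: NavierStokesRegularity · status: open · opened planner-decomp-ns-writer-1-g3-0 2026-08-30T05:48:56Z · rev 0 · ledger route-NavierStokesRegularity-RootDecompChiralityLadder
GENERATED by the gate from the ledger (D-0016/17). Provers cite these decls: `theorem foo : Summit.NavierStokesRegularity.NavierStokesRegularity.Theses.RootDecompChiralityLadder.<Decl> := …` in Summits/NavierStokesRegularity/NavierStokesRegularity/Theorems/<Name>.lean.
-/

namespace Summit.NavierStokesRegularity.NavierStokesRegularity.Theses.RootDecompChiralityLadder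

open scoped BigOperators Topology Manifold Classical MeasureTheory ProbabilityTheory Matrix InnerProductSpace ComplexConjugate ContinuousMap
open Filter Set Function TopologicalSpace MeasureTheory

attribute [summit_statement] _root_.NavierStokesRegularity

open Literature.NS

/-- item stmt-NavierStokesRegularity-28741 · crux · rank 2 · open · by planner
why it might fail: only through the regularity bookkeeping of the sector balance law along tree classical solutions (time-differentiability of h_σ, finiteness of d_σ before T); the Gronwall chain itself is checked exponent by exponent.
sources: arXiv:2203.07950, arXiv:1505.00142, arXiv:1303.1215, EscauriazaSereginSverak2003
[crux] ONE-SECTOR DISSIPATION CRITERION (X₁, r = 2 rung; WEAKER · ATTACKABLE NOW) — for ν>0, T>0 and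
(u,p) classical NS on ℝ³×[0,T), Leray–Hopf from the rapidly decaying slice u(0): if for some σ ∈
{1,−1} the spin-σ sector has finite Ḣ^{3/2}-dissipation on (0,T) (certified by a measurable
integrable majorant), then u extends smoothly past T. [difficulty: L] -/
@[route_item "route-NavierStokesRegularity-RootDecompChiralityLadder", crux]
def OneSectorDissipationExtends : Prop :=
  ∀ (ν T : ℝ), 0 < ν → 0 < T → ∀ (u : ℝ → EuclideanSpace ℝ (Fin 3) → EuclideanSpace ℝ (Fin 3)) (p : ℝ → EuclideanSpace ℝ (Fin 3) → ℝ), Literature.Analysis.FluidPDE.IsClassicalNSSolutionOn (Set.Ico 0 T) ν 0 u p → Literature.Analysis.FluidPDE.IsLerayHopfOn T ν 0 (u 0) u → Literature.Analysis.FluidPDE.HasRapidSpatialDecay (u 0) → (∃ σ : ℝ, (σ = 1 ∨ σ = -1) ∧ Literature.Analysis.FluidPDE.HelicalSector.DissipationFiniteOn σ u T) → Literature.Analysis.FluidPDE.HasSmoothExtensionPast ν 0 u T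

/-- item stmt-NavierStokesRegularity-28742 · crux · rank 3 · open · by planner
why it might fail: a Type-II blow-up whose minor sector stays Ḣ^{1/2}-bounded while out-dissipating the major one at ever higher frequencies is excluded by nothing known; the transfer bound needs the supercritical ‖u⁺‖_{Ḣ²}.
sources: arXiv:2203.07950, arXiv:1505.00142, CheminZhangZhang2017, EscauriazaSereginSverak2003
[crux] ONE-SECTOR ESS (X₂, r = ∞ rung; WEAKER · IDEA-NEEDED) — same frame: if for some σ ∈ {1,−1}
the spin-σ sector is bounded in Ḣ^{1/2} on [0,T) by a finite M, then u extends smoothly past T.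
[difficulty: open-problem] -/
@[route_item "route-NavierStokesRegularity-RootDecompChiralityLadder", crux]
def OneSectorCriticalExtends : Prop :=
  ∀ (ν T : ℝ), 0 < ν → 0 < T → ∀ (u : ℝ → EuclideanSpace ℝ (Fin 3) → EuclideanSpace ℝ (Fin 3)) (p : ℝ → EuclideanSpace ℝ (Fin 3) → ℝ), Literature.Analysis.FluidPDE.IsClassicalNSSolutionOn (Set.Ico 0 T) ν 0 u p → Literature.Analysis.FluidPDE.IsLerayHopfOn T ν 0 (u 0) u → Literature.Analysis.FluidPDE.HasRapidSpatialDecay (u 0) → (∃ σ : ℝ, (σ = 1 ∨ σ = -1) ∧ Literature.Analysis.FluidPDE.HelicalSector.CriticallyBoundedOn σ u T) → Literature.Analysis.FluidPDE.HasSmoothExtensionPast ν 0 u T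

/-- item stmt-NavierStokesRegularity-28743 · crux · rank 4 · open · by planner
why it might fail: it is NoTypeII (0056) off the two chirally polarised cells: every mirror-symmetric blow-up candidate (e.g. Luo–Hou 2014) and morally Tao's averaged cascade live here; no attack is proposed.
sources: arXiv:1402.0290, arXiv:2107.06509, arXiv:2203.07950, Fefferman2000
[crux] NO AMBICHIRAL TYPE-II BLOW-UP (X₃′, DECLARED RESIDUAL; weaker than 0056 by kernel) — same
frame: if u is NOT Type I at T and for every σ ∈ {1,−1} the spin-σ sector has infinite
Ḣ^{3/2}-dissipation on (0,T) and is unbounded in Ḣ^{1/2} on [0,T), then u extends smoothly past T.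
[difficulty: open-problem] -/
@[route_item "route-NavierStokesRegularity-RootDecompChiralityLadder", crux]
def NoAmbichiralTypeIIBlowup : Prop :=
  ∀ (ν T : ℝ), 0 < ν → 0 < T → ∀ (u : ℝ → EuclideanSpace ℝ (Fin 3) → EuclideanSpace ℝ (Fin 3)) (p : ℝ → EuclideanSpace ℝ (Fin 3) → ℝ), Literature.Analysis.FluidPDE.IsClassicalNSSolutionOn (Set.Ico 0 T) ν 0 u p → Literature.Analysis.FluidPDE.IsLerayHopfOn T ν 0 (u 0) u → Literature.Analysis.FluidPDE.HasRapidSpatialDecay (u 0) → ¬ Literature.Analysis.FluidPDE.IsTypeIBlowup u T → (∀ σ : ℝ, (σ = 1 ∨ σ = -1) → ¬ Literature.Analysis.FluidPDE.HelicalSector.DissipationFiniteOn σ u T) → (∀ σ : ℝ, (σ = 1 ∨ σ = -1) → ¬ Literature.Analysis.FluidPDE.HelicalSector.CriticallyBoundedOn σ u T) → Literature.Analysis.FluidPDE.HasSmoothExtensionPast ν 0 u T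

/-- item stmt-NavierStokesRegularity-1217 · crux · rank 5 · open · by planner
why it might fail: a backward self-similar / DSS Type-I profile realised from a Schwartz datum refutes it; the Liouville conjecture for bounded ancient mild solutions (KNSS) is open.
sources: arXiv:0709.3599, KochNadirashviliSereginSverak2009, arXiv:1811.00502
[target] X = NO TYPE-I BLOW-UP FOR CLAY DATA: a classical solution of unforced NS on ℝ³×[0,T) which
is Leray–Hopf from a rapidly decaying datum and blows up at most at the Type-I rate ‖u(t)‖∞ ≤
C(T−t)^{-1/2} extends smoothly past T. Equals UnthreadedNoBlowup ∧ ThreadedNoBlowup by excluded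
middle on 'every point is unthreaded' (proved in the planner's Sketch.lean: target_of_cruxes); it is
the unconditional conclusion of stmt-NavierStokesRegularity-0058 (route TypeILiouville, which
assumes (L)). With NoTypeII (stmt-0056) it gives NoBlowup (stmt-0054). Card:
threading-flux-trace-topology. -/
@[route_item "route-NavierStokesRegularity-RootDecompChiralityLadder", crux]
def NoTypeIBlowup : Prop :=
  ∀ (ν T : ℝ), 0 < ν → 0 < T → ∀ (u : ℝ → EuclideanSpace ℝ (Fin 3) → EuclideanSpace ℝ (Fin 3)) (p : ℝ → EuclideanSpace ℝ (Fin 3) → ℝ), Literature.Analysis.FluidPDE.IsClassicalNSSolutionOn (Set.Ico 0 T) ν 0 u p → Literature.Analysis.FluidPDE.IsLerayHopfOn T ν 0 (u 0) u → Literature.Analysis.FluidPDE.HasRapidSpatialDecay (u 0) → Literature.Analysis.FluidPDE.IsTypeIBlowup u T → Literature.Analysis.FluidPDE.HasSmoothExtensionPast ν 0 u T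

/-- item stmt-NavierStokesRegularity-28744 · aside · rank 9 · open · by planner
sources: arXiv:2203.07950, arXiv:1505.00142
[support] RUNG OF RECORD R₀ (COSTUME(cite): Lerner–Vigneron Thm 9 / Lei–Lin–Zhou with GKP16 = tree
fact hasSmoothExtensionPast_of_eLpNorm_three_bounded_holds) — same frame: if one sector is bounded
in Ḣ^{1/2} AND has finite Ḣ^{3/2}-dissipation, u extends; below X₁ and X₂. [difficulty: M] -/
@[route_item "route-NavierStokesRegularity-RootDecompChiralityLadder"]
def OneSectorCriticalEnergyExtends : Prop :=
  ∀ (ν T : ℝ), 0 < ν → 0 < T → ∀ (u : ℝ → EuclideanSpace ℝ (Fin 3) → EuclideanSpace ℝ (Fin 3)) (p : ℝ → EuclideanSpace ℝ (Fin 3) → ℝ), Literature.Analysis.FluidPDE.IsClassicalNSSolutionOn (Set.Ico 0 T) ν 0 u p → Literature.Analysis.FluidPDE.IsLerayHopfOn T ν 0 (u 0) u → Literature.Analysis.FluidPDE.HasRapidSpatialDecay (u 0) → (∃ σ : ℝ, (σ = 1 ∨ σ = -1) ∧ Literature.Analysis.FluidPDE.HelicalSector.CriticallyBoundedOn σ u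 T ∧ Literature.Analysis.FluidPDE.HelicalSector.DissipationFiniteOn σ u T) → Literature.Analysis.FluidPDE.HasSmoothExtensionPast ν 0 u T

/-- item stmt-NavierStokesRegularity-28745 · aside · rank 9 · open · by planner
sources: arXiv:2203.07950, arXiv:1505.00142
[support] RUNG R_ε below X₂ (BC5 witness, plan-only, EXPECTED THEOREM by bootstrap) — for every ν>0
and every bound K on the initial major sector there is ε>0 such that, in the same frame, if for some
σ ∈ {1,−1} the spin-(−σ) sector of u(0) has squared Ḣ^{1/2}-seminorm ≤ K and the spin-σ sector stays
≤ ε in squared Ḣ^{1/2}-seminorm on [0,T), then u extends smoothly past T (large data allowed).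
[difficulty: M] -/
@[route_item "route-NavierStokesRegularity-RootDecompChiralityLadder"]
def SmallSectorExtends : Prop :=
  ∀ ν : ℝ, 0 < ν → ∀ K : NNReal, ∃ ε : NNReal, 0 < ε ∧ ∀ T : ℝ, 0 < T → ∀ (u : ℝ → EuclideanSpace ℝ (Fin 3) → EuclideanSpace ℝ (Fin 3)) (p : ℝ → EuclideanSpace ℝ (Fin 3) → ℝ), Literature.Analysis.FluidPDE.IsClassicalNSSolutionOn (Set.Ico 0 T) ν 0 u p → Literature.Analysis.FluidPDE.IsLerayHopfOn T ν 0 (u 0) u → Literature.Analysis.FluidPDE.HasRapidSpatialDecay (u 0) → (∃ σ : ℝ, (σ = 1 ∨ σ = -1) ∧ Literature.Analysis.FluidPDE.HelicalSector.eSeminormSq (-σ) (1 / 2 : ℝ) (u 0) ≤ (K : ENNReal) ∧ ∀ t ∈ Set.Ico 0 T, Literature.Analysis.FluidPDE.HelicalSector.eSeminormSq σ (1 / 2 : ℝ) (u t) ≤ (ε : ENNReal)) → Literature.Analysis.FluidPDE.HasSmoothExtensionPast ν 0 u T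

/-- item stmt-NavierStokesRegularity-28746 · aside · rank 9 · open · by planner
sources: arXiv:2203.07950, arXiv:1505.00142, EscauriazaSereginSverak2003
[support] BC3 STUB of X₁ (the PDE content) — same frame: finite Ḣ^{3/2}-dissipation of one helical
sector bounds the FULL solution in Ḣ^{1/2} on [0,T) (sector balance law + transfer bound + helicity
identity + Gronwall); with the Ḣ^{1/2}-ESS endpoint (proved in the seat file from
FluidComputer.CriticalDivergence) it gives X₁. [difficulty: L] -/
@[route_item "route-NavierStokesRegularity-RootDecompChiralityLadder"]
def ChiralGronwallBound : Prop :=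
  ∀ (ν T : ℝ), 0 < ν → 0 < T → ∀ (u : ℝ → EuclideanSpace ℝ (Fin 3) → EuclideanSpace ℝ (Fin 3)) (p : ℝ → EuclideanSpace ℝ (Fin 3) → ℝ), Literature.Analysis.FluidPDE.IsClassicalNSSolutionOn (Set.Ico 0 T) ν 0 u p → Literature.Analysis.FluidPDE.IsLerayHopfOn T ν 0 (u 0) u → Literature.Analysis.FluidPDE.HasRapidSpatialDecay (u 0) → (∃ σ : ℝ, (σ = 1 ∨ σ = -1) ∧ Literature.Analysis.FluidPDE.HelicalSector.DissipationFiniteOn σ u T) → ∃ M : NNReal, ∀ t ∈ Set.Ico 0 T, Function.eHomSobolevSeminorm (1 / 2 : ℝ) (Literature.Analysis.FunctionSpaces.EuclideanSpace.complexify ∘ u t) ≤ (M : ENNReal)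

/-- item stmt-NavierStokesRegularity-28747 · assembly · rank 1 · open · by planner
sources: arXiv:2203.07950
[assembly] X₁ → X₂ → X₃′ → P1 → NavierStokesRegularity -/
@[route_item "route-NavierStokesRegularity-RootDecompChiralityLadder"]
def Assembly : Prop :=
  OneSectorDissipationExtends → OneSectorCriticalExtends → NoAmbichiralTypeIIBlowup → NoTypeIBlowup → NavierStokesRegularity

/-! D-0027 §2.1 — DECIDING THEOREM (planner-authored via `route open/edit --closes-file`; by planner-decomp-ns-writer-1-g3-0 2026-08-30T05:48:56Z):
its hypotheses are this route's items and its conclusion the sub-problem Statement (glue_lint), and it elaborates with this file. -/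

@[closes "route-NavierStokesRegularity-RootDecompChiralityLadder"] theorem closes (h₁ : OneSectorDissipationExtends) (h₂ : OneSectorCriticalExtends)
    (h₃ : NoAmbichiralTypeIIBlowup) (hP : NoTypeIBlowup) : NavierStokesRegularity := by
  refine Summit.NavierStokesRegularity.NavierStokesRegularity.Theorems.navierStokesRegularity_of_noBlowup ?_
  intro ν T hν hT u p hcl hLH hdec
  by_cases hI : Literature.Analysis.FluidPDE.IsTypeIBlowup u T
  · exact hP ν T hν hT u p hcl hLH hdec hI
  by_cases hd : ∃ σ : ℝ, (σ = 1 ∨ σ = -1) ∧ Literature.Analysis.FluidPDE.HelicalSector.DissipationFiniteOn σ u T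
  · exact h₁ ν T hν hT u p hcl hLH hdec hd
  by_cases hc : ∃ σ : ℝ, (σ = 1 ∨ σ = -1) ∧ Literature.Analysis.FluidPDE.HelicalSector.CriticallyBoundedOn σ u T
  · exact h₂ ν T hν hT u p hcl hLH hdec hc
  push Not at hd hc
  exact h₃ ν T hν hT u p hcl hLH hdec hI hd hc

end Summit.NavierStokesRegularity.NavierStokesRegularity.Theses.RootDecompChiralityLadder
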